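/-
COR-CM (cell pub-hodgecm2) — ¬hJ RUSH, track M1′ (nothj-plan table r3; LEAD d2bridge-wb-9), seat nothj-p6 g0 (prover-pub-hodgecm2-nothj-p6-g0-0).
THE TWO-SOCKET ENGINE: pure module algebra (Mathlib only).  THEOREMS ONLY; no `def`, no named fact, no `sorry`.
FRAMING: HC_CM is NOT proved; nothing here asserts hJ, hJ₀ or their negations.
-/
import Mathlib

/-!
# ¬hJ₀, finish line HEAD-A: two injections of one module into a multiplicity-free semisimple module with SEPARATED images cannot coexist

[Liu2021] Y. Liu, *Fourier–Jacobi cycles and arithmetic relative trace formula*, Camb. J. Math. **9** (2021) = arXiv:2102.11518.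

THE SHAPE (nothj-p4's P-HEAD design, pub-hodgecm2/INBOX l.≈18590; wb-9 NOT-HJ-CENSUS v2 §4).  At the pin the tree holds, rows-free, TWO
`ℂ[G]`-linear injections of the SAME module `W := ℂ ⊗ Ω(ν)` into the tower `T := 𝔇.H`: the (4.3) map of a HYPOTHETICAL ι₁-instance
component-Albanese record `J₁` (conj-keyed socket ✔ `MuKeyHazard.socket_conjAdm_of_componentAlbanese_iota1` ⇒ its classes restrict into
`H^{0,1}` of every small level) and the (4.3) map of the GENUINE ῑ₁-instance record ✔ `componentAlbanesePinTotal` (live-keyed socket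
✔ `adapter_socket_sharedTail` ⇒ `H^{1,0}`); injectivity of each is law (v′) of its own record.  If `T` is a SEMISIMPLE `ℂ[G]`-module in which
isomorphic simple submodules COINCIDE (multiplicity one — the END-ELECT's Hodge-blind displayed rows h413 [Prop. 4.13] ∕ h411 [Def. 4.11] ∕ hμsep,
hD3 [Lem. D.1 (3)], see `multiplicityFree_of_iSupIndep_simple`) and `W ≠ 0` (the displayed row `hHom`, [Liu2021] Thm. 4.18 first clause), then the
two injections agree on a simple `S ≤ W` (`exists_ne_bot_map_eq_of_multiplicityFree`), whose common image is a non-zero `ℂ[G]`-submodule of `T`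
with every admissible restriction in `H^{1,0} ∩ H^{0,1} = 0` — contradicting tower SEPARATION (✔ `submodule_tower_eq_bot_of_res_eq_zero`):
`false_of_twoSocket_of_multiplicityFree`.  No complex conjugation of varieties, no tower Hodge splitting, no placement row, no purity row.

Everything is abstract: `R` a ring (at the pin `MonoidAlgebra ℂ ↥V.adelicFin`), `T` an `R`-module, levels `i : Λ` with plain restriction maps
`res i : T → V i` and an admissibility predicate `adm i`, disjoint `ℂ`-submodules `V₁₀ i ∕ V₀₁ i` of the level targets (at the pin the Hodge pieces
of `H¹(P_Γ; ℂ)`, disjoint by ✔ `disjoint_hodgePiece_one_zero`).  HC_CM is NOT proved; hJ ∕ ¬hJ are not asserted.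

## References
* [Liu2021] Prop. 4.13 (FJcycle.tex l. 2113–2119), Def. 4.11, App. D Lem. D.1 (3), Thm. 4.18 (1),(2) (l. 2232–2245).
* [VoisinHodgeI2002] C. Voisin, *Hodge Theory and Complex Algebraic Geometry I*, CUP 2002, §6.1.3 Cor. 6.14; §7.3.2.
* [Bump1997] D. Bump, *Automorphic forms and representations*, CUP 1997, Prop. 4.2.4 (Schur).
-/

set_option autoImplicit false

namespace Summit.HodgeConjecture.CorCM.D2Bridge.NotHJ

open Function

/-! ## §1 The two-socket engine

At the pin the tree already holds, rows-free, TWO `ℂ[G]`-linear injections of the SAME module `W := ℂ ⊗ Ω(ν)` into the tower `T = 𝔇.H`: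
`J` (the (4.3) map of the HYPOTHETICAL ι₁-record `J₁`, conj-keyed socket ✔ `socket_conjAdm_of_componentAlbanese_iota1` ⇒ classes restricting into
`H^{0,1}`) and `J′` (the (4.3) map of the GENUINE ῑ₁-record ✔ `componentAlbanesePinTotal`, live-keyed socket ✔ `adapter_socket_sharedTail` ⇒
classes restricting into `H^{1,0}`).  If `T` is a SEMISIMPLE `ℂ[G]`-module in which isomorphic simple submodules COINCIDE (multiplicity one —
the Hodge-blind displayed rows h413 ∕ h411 ∕ hμsep of the END-ELECT, [Liu2021] Prop. 4.13, Def. 4.11, Lem. D.1 (3)) and `W ≠ 0` ((P-N), [Liu2021]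
Thm. 4.18 first clause ∕ the `hHom` row), then `J(S) = J′(S)` for a simple `S ≤ W`, a non-zero `ℂ[G]`-submodule of `T` whose admissible restrictions
lie in `H^{1,0} ∩ H^{0,1} = 0` — contradicting SEPARATION.  No conjugation `κ`, no tower Hodge splitting, no placement, no purity row. -/

section TwoSocket

variable {R : Type*} [Ring R] {T' : Type*} [AddCommGroup T'] [Module R T'] {W' : Type*} [AddCommGroup W'] [Module R W']
variable {Λ' : Type*} {V' : Λ' → Type*} [∀ i, AddCommGroup (V' i)] [∀ i, Module ℂ (V' i)]

/-- **Multiplicity one, two injections ⇒ a common non-zero image.**  In a semisimple `R`-module `T` in which isomorphic simple submodules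
coincide, two injective `R`-linear maps `J J′ : W → T` out of a non-trivial `W` agree on some non-zero submodule: `J(S) = J′(S)`, `S ≠ ⊥`
(take `S ≤ W` simple — `W` is semisimple as a submodule of `T` — and compare the simple submodules `J(S) ≃ S ≃ J′(S)` of `T`).
[cite: Liu2021, Prop. 4.13 and Thm. 4.18 (2)] -/
theorem exists_ne_bot_map_eq_of_multiplicityFree [IsSemisimpleModule R T']
    (hmf : ∀ S S' : Submodule R T', IsSimpleModule R S → IsSimpleModule R S' → Nonempty (S ≃ₗ[R] S') → S = S')
    (J J' : W' →ₗ[R] T') (hJ : Injective J) (hJ' : Injective J') [Nontrivial W'] :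
    ∃ S : Submodule R W', S ≠ ⊥ ∧ S.map J = S.map J' := by
  haveI : IsSemisimpleModule R W' := IsSemisimpleModule.of_injective J hJ
  obtain ⟨S, hS⟩ := IsSemisimpleModule.exists_simple_submodule (R := R) (M := W')
  haveI := hS
  have eJ : S ≃ₗ[R] S.map J := Submodule.equivMapOfInjective J hJ S
  have eJ' : S ≃ₗ[R] S.map J' := Submodule.equivMapOfInjective J' hJ' S
  haveI : IsSimpleModule R (S.map J) := IsSimpleModule.congr eJ.symm
  haveI : IsSimpleModule R (S.map J') := IsSimpleModule.congr eJ'.symm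
  refine ⟨S, ?_, hmf _ _ inferInstance inferInstance ⟨eJ.symm.trans eJ'⟩⟩
  intro h
  haveI : Nontrivial S := IsSimpleModule.nontrivial R S
  obtain ⟨⟨x, hx⟩, hx0⟩ := exists_ne (0 : S)
  apply hx0
  rw [h] at hx
  exact Subtype.ext ((Submodule.mem_bot R).1 hx)

/-- **THE TWO-SOCKET ENGINE.**  `T` a semisimple multiplicity-free `R`-module with SEPARATION over admissible restrictions `res i : T → V i`
into DISJOINT pieces `V₁₀ i ∕ V₀₁ i`; `J J′ : W → T` injective `R`-linear with `J(W)` restricting into the `(0,1)`-pieces and `J′(W)` into the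
`(1,0)`-pieces; `W` non-trivial.  Then `False`.  (At the pin: `R = ℂ[U(V)(𝔸_f)]`, `T = 𝔇.H`, `W = ℂ ⊗ Ω(ν)`, `J ∕ J′` = the (4.3) maps of the
hypothetical ι₁-record and of ✔ `componentAlbanesePinTotal`, typings by ✔ `hcm_of_pieces` through the conj-keyed ∕ live-keyed sockets,
SEPARATION = ✔ `submodule_tower_eq_bot_of_res_eq_zero`, disjointness = ✔ `BettiUniverse.disjoint_hodge_piece`.)
[cite: Liu2021, Prop. 4.13, Thm. 4.18 (1),(2)] [cite: VoisinHodgeI2002, §6.1.3 Cor. 6.14 and §7.3.2] -/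
theorem false_of_twoSocket_of_multiplicityFree [IsSemisimpleModule R T']
    (hmf : ∀ S S' : Submodule R T', IsSimpleModule R S → IsSimpleModule R S' → Nonempty (S ≃ₗ[R] S') → S = S')
    (res : ∀ i : Λ', T' → V' i) (adm : Λ' → T' → Prop) (V₁₀ V₀₁ : ∀ i : Λ', Submodule ℂ (V' i))
    (hdisj : ∀ i, Disjoint (V₁₀ i) (V₀₁ i))
    (sep : ∀ N : Submodule R T', (∀ i, ∀ y ∈ N, adm i y → res i y = 0) → N = ⊥)
    (J J' : W' →ₗ[R] T') (hJ : Injective J) (hJ' : Injective J') [Nontrivial W']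
    (hJ₀₁ : ∀ i w, adm i (J w) → res i (J w) ∈ V₀₁ i) (hJ'₁₀ : ∀ i w, adm i (J' w) → res i (J' w) ∈ V₁₀ i) : False := by
  obtain ⟨S, hS, hSS⟩ := exists_ne_bot_map_eq_of_multiplicityFree hmf J J' hJ hJ' 
  have hN : S.map J = ⊥ := by
    refine sep _ ?_
    rintro i y ⟨w, hw, rfl⟩ hadm
    have h01 : res i (J w) ∈ V₀₁ i := hJ₀₁ i w hadm
    have hmem : J w ∈ S.map J' := by rw [← hSS]; exact ⟨w, hw, rfl⟩
    obtain ⟨w', -, hw'⟩ := hmem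
    have h10 : res i (J w) ∈ V₁₀ i := by rw [← hw'] at hadm ⊢; exact hJ'₁₀ i w' hadm
    exact (Submodule.disjoint_def.1 (hdisj i)) _ h10 h01
  apply hS
  rw [eq_bot_iff]
  intro x hx
  have hJx : J x ∈ S.map J := ⟨x, hx, rfl⟩
  rw [hN, Submodule.mem_bot] at hJx
  rw [Submodule.mem_bot]
  exact hJ (by rw [hJx, map_zero])

/-- A simple submodule ISOMORPHIC to a summand `ω t` of an independent decomposition `⨆ ω = ⊤` into simple, pairwise non-isomorphic
submodules is CONTAINED in that summand (otherwise it meets `ω t` trivially, so it projects injectively into the complement `⨆_{j ≠ t} ω j`, whose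
simple submodules are isomorphic to some `ω j`, `j ≠ t` — contradicting pairwise non-isomorphy). [cite: Liu2021, Prop. 4.13 and Lem. D.1 (3)] -/
theorem le_of_linearEquiv_of_iSupIndep_simple {ι : Type*} (ω : ι → Submodule R T')
    (hsimple : ∀ t, IsSimpleModule R (ω t)) (hsep : ∀ t t', Nonempty (ω t ≃ₗ[R] ω t') → t = t')
    (hind : iSupIndep ω) (htop : ⨆ t, ω t = ⊤)
    (m : Submodule R T') [IsSimpleModule R m] (t : ι) (e : m ≃ₗ[R] ω t) : m ≤ ω t := by
  classical
  by_contra hmt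
  -- `m ⊓ ω t = ⊥`
  have hatom : IsAtom m := isSimpleModule_iff_isAtom.mp inferInstance
  have hinf : m ⊓ ω t = ⊥ := by
    rcases hatom.le_iff.mp (inf_le_left : m ⊓ ω t ≤ m) with h | h
    · exact h
    · exact absurd (h.symm ▸ inf_le_right : m ≤ ω t) hmt
  -- the complement `C := ⨆_{j ≠ t} ω j`
  set C : Submodule R T' := ⨆ (j : ι) (_ : j ≠ t), ω j with hCdef
  have hC : IsCompl C (ω t) := by
    refine IsCompl.symm ⟨(iSupIndep_def.mp hind t), ?_⟩
    rw [codisjoint_iff, ← iSup_split_single ω t, htop]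
  -- projection onto `C` along `ω t`, injective on `m`
  set proj : T' →ₗ[R] C := Submodule.projectionOnto C (ω t) hC with hproj
  set f : m →ₗ[R] T' := (C.subtype.comp proj).domRestrict m with hf
  have hfinj : Injective f := by
    rw [← LinearMap.ker_eq_bot, eq_bot_iff]
    rintro ⟨x, hx⟩ hx0
    rw [LinearMap.mem_ker] at hx0
    have hp : proj x = 0 := by
      have h1 : (C.subtype (proj x)) = 0 := hx0
      exact Subtype.ext (by simpa using h1)
    have hxt : x ∈ ω t := by
      rw [← Submodule.ker_projectionOnto hC]
      exact hp
    have : x ∈ m ⊓ ω t := ⟨hx, hxt⟩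
    rw [hinf, Submodule.mem_bot] at this
    exact (Submodule.mem_bot R).2 (Subtype.ext this)
  set N : Submodule R T' := LinearMap.range f with hN
  have eN : m ≃ₗ[R] N := LinearEquiv.ofInjective f hfinj
  haveI : IsSimpleModule R N := IsSimpleModule.congr eN.symm
  have hNC : N ≤ sSup (ω '' {j | j ≠ t}) := by
    rw [sSup_image]
    change N ≤ C
    rintro _ ⟨x, rfl⟩
    exact (proj x).2
  haveI : ∀ m' : (ω '' {j | j ≠ t} : Set (Submodule R T')), IsSimpleModule R m' := by
    rintro ⟨_, j, _, rfl⟩; exact hsimple j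
  obtain ⟨_, ⟨j, hj, rfl⟩, ⟨eNj⟩⟩ := N.linearEquiv_of_le_sSup _ hNC
  exact hj (hsep j t ⟨(eNj.symm.trans eN.symm).trans e⟩)

/-- **Multiplicity one from a decomposition AS PRINTED** ([Liu2021] Prop. 4.13 shape + Def. 4.11 + Lem. D.1 (3)): if `T` is the independent
sup of SIMPLE, PAIRWISE NON-ISOMORPHIC submodules `ω t`, then every simple submodule of `T` IS one of the `ω t`, hence isomorphic simple
submodules of `T` coincide — the hypothesis `hmf` of `false_of_twoSocket_of_multiplicityFree`. [cite: Liu2021, Prop. 4.13, Def. 4.11 and Lem. D.1 (3)] -/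
theorem multiplicityFree_of_iSupIndep_simple {ι : Type*} (ω : ι → Submodule R T')
    (hsimple : ∀ t, IsSimpleModule R (ω t)) (hsep : ∀ t t', Nonempty (ω t ≃ₗ[R] ω t') → t = t')
    (hind : iSupIndep ω) (htop : ⨆ t, ω t = ⊤)
    (S S' : Submodule R T') (hS : IsSimpleModule R S) (hS' : IsSimpleModule R S') (e : Nonempty (S ≃ₗ[R] S')) : S = S' := by
  haveI := hS; haveI := hS'
  have hsSup : sSup (Set.range ω) = ⊤ := by rw [sSup_range]; exact htop
  haveI : ∀ m : (Set.range ω : Set (Submodule R T')), IsSimpleModule R m := by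
    rintro ⟨_, t, rfl⟩; exact hsimple t
  -- every simple submodule of `T` equals a summand
  have key : ∀ (U : Submodule R T') [IsSimpleModule R U], ∃ t, U = ω t := by
    intro U hU
    obtain ⟨_, ⟨t, rfl⟩, ⟨eU⟩⟩ := U.linearEquiv_of_sSup_eq_top _ hsSup
    refine ⟨t, ?_⟩
    have hle : U ≤ ω t := le_of_linearEquiv_of_iSupIndep_simple ω hsimple hsep hind htop U t eU
    haveI := hsimple t
    rcases (isSimpleModule_iff_isAtom.mp (hsimple t)).le_iff.mp hle with h | h
    · exact absurd h (isSimpleModule_iff_isAtom.mp hU).1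
    · exact h
  obtain ⟨t, rfl⟩ := key S
  obtain ⟨t', rfl⟩ := key S'
  exact congrArg ω (hsep t t' e)

/-- The decomposition also makes `T` SEMISIMPLE (the other standing hypothesis of `false_of_twoSocket_of_multiplicityFree`).
[cite: Liu2021, Prop. 4.13] -/
theorem isSemisimpleModule_of_iSup_simple_eq_top {ι : Type*} (ω : ι → Submodule R T')
    (hsimple : ∀ t, IsSimpleModule R (ω t)) (htop : ⨆ t, ω t = ⊤) : IsSemisimpleModule R T' := by
  refine isSemisimpleModule_of_isSemisimpleModule_submodule' (p := ω) (fun t => ?_) htop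
  haveI := hsimple t; infer_instance

end TwoSocket

end Summit.HodgeConjecture.CorCM.D2Bridge.NotHJ
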